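import Mathlib
import Literature.NumberTheory.Automorphic.BianchiConeModel

/-!
# Hyperbolic `3`-space, its `GL₂(ℂ)`-action, the Laplace–Beltrami operator, and Maass cusp forms
# for Bianchi groups

Topic `NumberTheory/Automorphic`; namespace `Literature.NumberTheory.Automorphic`, grouping
sub-namespaces `UpperHalfSpace` (the space `ℍ³` and its API) and `Bianchi` (congruence subgroups of
`SL₂(𝓞_K)`, Hecke operators). Definitions with body and proved API lemmas only; no named facts.
This is the `ℍ³`/`SL₂(ℂ)` mirror of the `ℍ`/`SL₂(ℝ)` objects `IsC2`, `hypLaplacian`, `IsAutomorphic`,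
`Fuchsian.IsMaassCuspForm` (`HyperbolicLaplaceSpectrum.lean`, `FuchsianMaassCuspForms.lean`).

1. **Upper half-space** `ℍ³ = ℂ × ]0, ∞[ = {P = z + rj : z ∈ ℂ, r > 0}` (a point of `ℍ³` is written
   `P = (z, r) = z + rj` in the quaternions, [ElstrodtGrunewaldMennicke1998, Ch. 1 §1.1],
   [BlomerHarcosMilicevic2016, §1 (P = z + rj)]): `UpperHalfSpace`, the subtype `{p : ℂ × ℝ // 0 < p.2}`
   of the real normed space `ℂ × ℝ` (so that it inherits topology and measurable structure and
   calculus is done on the ambient space, exactly as Mathlib's `ℍ ⊆ ℂ`), with coordinates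
   `UpperHalfSpace.z`, `UpperHalfSpace.r`.
2. **The action of `GL₂(ℂ)`.** `ℍ³ = SL₂(ℂ)/SU(2)` with Iwasawa coordinates
   `(z, r) ↦ n_z a_r = (1 z; 0 1)(√r 0; 0 1/√r)` ([Garrett2018, §1.3, §1.6]); the map
   `g SU(2) ↦ g gᴴ` identifies `ℍ³` with the positive definite Hermitian `2 × 2` matrices of
   determinant `1`, `(z, r) ↦ Q(z, r) = n_z a_r (n_z a_r)ᴴ = r⁻¹ (r² + |z|², z; z̄, 1)`
   (`UpperHalfSpace.toMat`), and intertwines left translation with `Q ↦ g Q gᴴ`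
   (`UpperHalfSpace.congr`; this is the tree's action `BianchiCone.act` of `(gᴴ)⁻¹` on the cone of
   positive definite Hermitian forms, `congr_eq_act` — points and forms are in duality,
   [ElstrodtGrunewaldMennicke1998, Ch. 1 §1.3]). Reading `g Q gᴴ` up to positive scalars
   (`UpperHalfSpace.ofMat`) gives a genuine `MulAction (GL (Fin 2) ℂ) ℍ³` in which the centre acts
   trivially (the action of `PGL₂(ℂ) = PSL₂(ℂ) ≅ Isom⁺(ℍ³)`, [BlomerHarcosMilicevic2016, §2]), and by
   restriction `MulAction SL(2, ℂ) ℍ³`. We PROVE the explicit formulas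
   [ElstrodtGrunewaldMennicke1998, Ch. 1 §1.1], [BlomerHarcosMilicevic2016, §2 (Im(gP)/Im(P) = |det g| / ‖cP + d‖²)]:
   `g • (z, r) = ( ((az + b)(c̄z̄ + d̄) + ac̄ r²) / (|cz + d|² + |c|²r²), |det g| r / (|cz + d|² + |c|²r²) )`
   (`UpperHalfSpace.smul_z`, `UpperHalfSpace.smul_r`), in particular
   `(a b; 0 d) • (z, r) = ((az + b)/d, |a/d| r)` (`smul_upperTriangular`), translations
   `(1 ω; 0 1) • (z, r) = (z + ω, r)` and the triviality of scalars.
3. **The Laplace–Beltrami operator** `Δ = r²(∂²_x + ∂²_y + ∂²_r) - r ∂_r` ([Garrett2018, §1.6];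
   [BlomerHarcosMilicevic2016, §1]; [ElstrodtGrunewaldMennicke1998, Ch. 1 §1.1]) on functions
   `U : ℂ × ℝ → ℂ` through Mathlib's `iteratedFDeriv`/`fderiv` in the three coordinate directions
   (`laplaceBeltrami`), and on `u : ℍ³ → ℂ` through the extension `u ∘ ofProd` (`hypLaplacian3`,
   mirror of `hypLaplacian f z = (Im z)² Δ_euclid (f ∘ ofComplex) z`); `IsC2 u` = the extension is `C²`
   on the open half-space. Sanity lemmas: `Δ c = 0`, and `Δ r = -r`, i.e. the height function `r = r^s|_{s=1}`
   solves `Δu + λu = 0` with `λ = s(2 - s) = 1` (`hypLaplacian3_r`) — the bottom `λ = 1` of the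
   tempered spectrum `λ = 1 + t²` ([BlomerHarcosMilicevic2016, §1, t = √(λ - 1)]).
4. **Maass cusp forms** (`IsBianchiMaassCuspForm Γ lam u` for a subgroup `Γ ≤ SL₂(ℂ)`): `u` is `C²`,
   `Γ`-invariant, `Δu + λu = 0`, bounded, and CUSPIDAL: at every cusp of `Γ` — every `A ∈ SL₂(ℂ)` such
   that `A⁻¹ΓA ∋ (1 ω; 0 1)` for the `ω` of a rank-`2` lattice `ℤω₁ ⊕ ℤω₂ ⊆ ℂ` — the zero-th Fourier
   coefficient `∫₀¹∫₀¹ u(A (1 sω₁+tω₂; 0 1) P) ds dt` of `u ∘ A` vanishes identically (the Gelfand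
   condition `c_P f = 0`, [Garrett2018, §1.7]; "cusp form", [BlomerHarcosMilicevic2016, §4]). Cusp
   forms are bounded (rapid decay in Siegel sets, [Garrett2018, §1.11, proof of Cor. 1.11.8]) and a
   bounded function has moderate growth, so `bounded` replaces the growth condition of an automorphic
   function without changing the class of cusp forms; for `λ ≠ 0` it alone already forces the
   vanishing of all constant terms `a r^s + b r^{2-s}` when `λ > 0` is real.
5. **Bianchi groups and Hecke operators** (`Bianchi.toSL2C K σ : SL₂(𝓞_K) →* SL₂(ℂ)` along an
   embedding `σ : K →+* ℂ`; `Bianchi.Gamma0 𝔫`, `Bianchi.Gamma1 𝔫`, `Bianchi.Gamma 𝔫 ≤ SL₂(R)` for an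
   ideal `𝔫` of any commutative ring, [BlomerHarcosMilicevic2016, §1 (Γ₀(N))]; and, for a non-zero
   PRINCIPAL `𝔭 = (ϖ)` — class number one first — the Hecke operator
   `T_ϖ u (P) = Σ_{b mod ϖ} u((1 b; 0 ϖ) P) + χ(ϖ) u((ϖ 0; 0 1) P)
            = Σ_{b mod ϖ} u((z + b)/ϖ, r/|ϖ|) + χ(ϖ) u(ϖz, |ϖ|r)`
   (`Bianchi.heckeOperator`; [BlomerHarcosMilicevic2016, §2, definition of `T_n`]: for `Γ₀(N) ≤ SL₂(ℤ[i])`, trivial `χ`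
   and `n = ϖ` prime their `T_n φ(P) = (4|n|)⁻¹ Σ_{ad = n} Σ_{b mod d} φ((a b; 0 d)P)` is `|ϖ|⁻¹ T_ϖ`, the
   factor `4 = #ℤ[i]ˣ` cancelling the unit multiples of `(a, d) = (1, ϖ), (ϖ, 1)`; the value `χ(ϖ)` is
   the eigenvalue of the diamond operator / central character on forms of level `Γ₁(𝔫) ≥ Γ ≥ Γ₀(𝔫)`).

What is NOT here: the invariant measure `dx dy dr / r³` and `L²(Γ\ℍ³)`, discreteness and finite
covolume of `SL₂(𝓞_K)` for `K` imaginary quadratic, Fourier–Bessel expansions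
`u(z + rj) = r Σ_{0 ≠ n} ρ(n) K_{it}(2π|n|r) e(Re(n z))`, Hecke operators at non-principal primes
(-- TODO(general form): `T_𝔭` for non-principal `𝔭` via `(a b; 0 d)` with `ad ∈ 𝔭`, [BlomerHarcosMilicevic2016, §2]),
self-adjointness and multiplicativity of the `T_n`, and any spectral theory. The held copy of
[ElstrodtGrunewaldMennicke1998] could not be opened this session (the store's PDF under that key is a
different book); its section numbers are cited as printed in [BlomerHarcosMilicevic2016, §2] ("See [EGM]
for more details") and in `BianchiConeModel.lean`, and every formula below is also cited to a source
read this session ([BlomerHarcosMilicevic2016], [Garrett2018]).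

## References
* [ElstrodtGrunewaldMennicke1998] J. Elstrodt, F. Grunewald, J. Mennicke, *Groups Acting on Hyperbolic
  Space*, Springer 1998, Ch. 1 §1.1 (upper half-space, `P = z + rj`, `M P = (aP + b)(cP + d)⁻¹`, the
  Laplace–Beltrami operator), §1.3 (Hermitian forms; section numbers as cited in `BianchiConeModel.lean`).

* [BlomerHarcosMilicevic2016] V. Blomer, G. Harcos, D. Milićević, *Bounds for eigenforms on arithmetic
  hyperbolic 3-manifolds*, Duke Math. J. 165 (2016), arXiv:1401.5154: §1 (`P = z + rj`, the Laplace
  operator, `Γ₀(N)`, `t = √(λ - 1)`); §2 (the action of `SL₂(ℂ)`/`GL₂(ℂ)`, `Im(gP)/Im(P)`, the Hecke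
  operators `T_n`); §4 (cusp forms, `λ = 1 + t²`, Fourier expansion).
* [Garrett2018] P. Garrett, *Modern Analysis of Automorphic Forms by Example*, vol. 1, CUP 2018, §1.3
  (Iwasawa coordinates `n_x a_y`, Claim 1.3.2), §1.6 (invariant Laplacian on `SL₂(ℂ)/SU(2)`:
  `y²(∂²_{x₁} + ∂²_{x₂} + ∂²_y) - y ∂_y`), §1.7 (constant term, cuspforms, Thm 1.7.1).
-/

noncomputable section

open Matrix Complex
open scoped MatrixGroups ComplexConjugate NumberField

namespace Literature.NumberTheory.Automorphic

/-! ## 1. The upper half-space `ℍ³` -/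

/-- **Hyperbolic `3`-space in the upper half-space model**: `ℍ³ = {(z, r) : z ∈ ℂ, r > 0}`, the point
`(z, r)` being the quaternion `P = z + rj` of [ElstrodtGrunewaldMennicke1998, Ch. 1 §1.1] /
[BlomerHarcosMilicevic2016, §1 (P = z + rj)] (`Im P = r`). A subtype of the real normed space `ℂ × ℝ`.
[cite: ElstrodtGrunewaldMennicke1998, Ch. 1 §1.1] -/
abbrev UpperHalfSpace : Type := {p : ℂ × ℝ // 0 < p.2}

@[inherit_doc] scoped[Literature.NumberTheory.Automorphic] notation "ℍ³" => UpperHalfSpace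

namespace UpperHalfSpace

/-- The coordinate `z ∈ ℂ` of `P = z + rj`. [cite: BlomerHarcosMilicevic2016, §1 (P = z + rj, Im P = r)] -/
def z (P : ℍ³) : ℂ := P.1.1

/-- The height `r = Im P > 0` of `P = z + rj`. [cite: BlomerHarcosMilicevic2016, §1 (P = z + rj, Im P = r)] -/
def r (P : ℍ³) : ℝ := P.1.2

/-- `r > 0`. [folklore] -/
theorem r_pos (P : ℍ³) : 0 < P.r := P.2

/-- `r ≠ 0`. [folklore] -/
theorem r_ne_zero (P : ℍ³) : P.r ≠ 0 := P.r_pos.ne'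

/-- The point `z + rj` for `r > 0`. [folklore] -/
def mk (z : ℂ) (r : ℝ) (hr : 0 < r) : ℍ³ := ⟨(z, r), hr⟩

/-- The base point `j = (0, 1)`. [folklore] -/
instance : Inhabited ℍ³ := ⟨mk 0 1 one_pos⟩

/-- The `z`-coordinate of `mk z r`. [folklore] -/
@[simp] theorem z_mk (z : ℂ) (r : ℝ) (hr : 0 < r) : (mk z r hr).z = z := rfl

/-- The `r`-coordinate of `mk z r`. [folklore] -/
@[simp] theorem r_mk (z : ℂ) (r : ℝ) (hr : 0 < r) : (mk z r hr).r = r := rfl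

/-- The base point `j = (0, 1)` has `z = 0`. [folklore] -/
@[simp] theorem z_default : (default : ℍ³).z = 0 := rfl

/-- The base point `j = (0, 1)` has `r = 1`. [folklore] -/
@[simp] theorem r_default : (default : ℍ³).r = 1 := rfl

/-- Two points with the same coordinates are equal. [folklore] -/
theorem ext_zr {P Q : ℍ³} (hz : P.z = Q.z) (hr : P.r = Q.r) : P = Q :=
  Subtype.ext (Prod.ext hz hr)

/-- Extension of the inclusion `ℍ³ ⊆ ℂ × ℝ` to a retraction `ℂ × ℝ → ℍ³` (junk value `(p.1, 1)` off the
open half-space), used — like Mathlib's `UpperHalfPlane.ofComplex` — to do calculus on functions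
`u : ℍ³ → ℂ` through `u ∘ ofProd : ℂ × ℝ → ℂ`. [folklore] -/
def ofProd (p : ℂ × ℝ) : ℍ³ := if h : 0 < p.2 then ⟨p, h⟩ else mk p.1 1 one_pos

/-- `ofProd` is a left inverse of the inclusion. [folklore] -/
@[simp] theorem ofProd_coe (P : ℍ³) : ofProd (P : ℂ × ℝ) = P := by
  unfold ofProd; rw [dif_pos P.2]

/-- On the open half-space `ofProd` is the identity. [folklore] -/
theorem ofProd_of_pos {p : ℂ × ℝ} (h : 0 < p.2) : ofProd p = ⟨p, h⟩ := by
  unfold ofProd; rw [dif_pos h]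

/-- The open half-space `{r > 0} ⊆ ℂ × ℝ` is open. [folklore] -/
theorem isOpen_halfSpace : IsOpen {p : ℂ × ℝ | 0 < p.2} :=
  isOpen_lt continuous_const continuous_snd

/-! ## 2. The action of `GL₂(ℂ)`: `ℍ³` as positive definite Hermitian matrices of determinant one -/

/-- **The positive definite Hermitian matrix of a point**: `Q(z, r) = n_z a_r (n_z a_r)ᴴ =
r⁻¹ (r² + |z|², z; z̄, 1)` for the Iwasawa coordinates `n_z a_r = (1 z; 0 1)(√r 0; 0 1/√r)` of
`SL₂(ℂ)/SU(2)`; it has determinant `1`. [cite: Garrett2018, §1.2–1.3 & §1.6] -/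
def toMat (P : ℍ³) : BianchiCone.Mat :=
  !![(((P.r ^ 2 + Complex.normSq P.z : ℝ) : ℂ)) / (P.r : ℂ), P.z / (P.r : ℂ);
     conj P.z / (P.r : ℂ), 1 / (P.r : ℂ)]

/-- **Reading a point off a positive multiple of some `Q(z, r)`**: for `Q' = t Q(z, r)`, `t > 0`, one has
`z = Q'₀₁ / Q'₁₁` and `r = √(det Q') / Q'₁₁` (junk value `j` when `Q'₁₁ ≤ 0` or `det Q' ≤ 0`).
[cite: Garrett2018, §1.3 Claim 1.3.2] -/
def ofMat (Q : BianchiCone.Mat) : ℍ³ :=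
  if h : 0 < (Q 1 1).re ∧ 0 < BianchiCone.hdet Q then
    mk (Q 0 1 / ((Q 1 1).re : ℂ)) (Real.sqrt (BianchiCone.hdet Q) / (Q 1 1).re)
      (div_pos (Real.sqrt_pos.2 h.2) h.1)
  else default

/-- **The point action in the Hermitian model**: `Q ↦ g Q gᴴ` (left translation `n a SU(2) ↦ g n a SU(2)`
read through `g SU(2) ↦ g gᴴ`). [cite: ElstrodtGrunewaldMennicke1998, Ch. 1 §1.3] -/
def congr (g : GL (Fin 2) ℂ) (Q : BianchiCone.Mat) : BianchiCone.Mat :=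
  (g : BianchiCone.Mat) * Q * (g : BianchiCone.Mat)ᴴ

/-- **Points versus forms**: `g Q gᴴ` is the tree's action `BianchiCone.act` (`k • H = (k⁻¹)ᴴ H k⁻¹` on
Hermitian forms) of `k = (gᴴ)⁻¹`. [cite: ElstrodtGrunewaldMennicke1998, Ch. 1 §1.3] -/
theorem congr_eq_act (g : GL (Fin 2) ℂ) (Q : BianchiCone.Mat) :
    congr g Q = BianchiCone.act (star g)⁻¹ Q := by
  rw [congr, BianchiCone.act, inv_inv, Units.coe_star, star_eq_conjTranspose,
    conjTranspose_conjTranspose]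

/-- `1 Q 1ᴴ = Q`. [folklore] -/
theorem congr_one (Q : BianchiCone.Mat) : congr 1 Q = Q := by
  simp [congr]

/-- `(g h) Q (g h)ᴴ = g (h Q hᴴ) gᴴ`. [folklore] -/
theorem congr_mul (g h : GL (Fin 2) ℂ) (Q : BianchiCone.Mat) : congr (g * h) Q = congr g (congr h Q) := by
  simp only [congr, Units.val_mul, conjTranspose_mul, Matrix.mul_assoc]

/-- `g (t Q) gᴴ = t (g Q gᴴ)` for real `t`. [folklore] -/
theorem congr_smul (g : GL (Fin 2) ℂ) (t : ℝ) (Q : BianchiCone.Mat) : congr g (t • Q) = t • congr g Q := by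
  simp only [congr, Matrix.mul_smul, Matrix.smul_mul]

/-- `g Q gᴴ` is Hermitian when `Q` is. [folklore] -/
theorem isHermitian_congr (g : GL (Fin 2) ℂ) {Q : BianchiCone.Mat} (hQ : Q.IsHermitian) :
    (congr g Q).IsHermitian := by
  rw [congr_eq_act]; exact BianchiCone.isHermitian_act _ hQ

/-- The real determinant of `g Q gᴴ` is `|det g|² · det Q` (`Q` Hermitian). [folklore] -/
theorem hdet_congr (g : GL (Fin 2) ℂ) {Q : BianchiCone.Mat} (hQ : Q.IsHermitian) :
    BianchiCone.hdet (congr g Q) = Complex.normSq ((g : BianchiCone.Mat).det) * BianchiCone.hdet Q := by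
  have h1 : (congr g Q).det =
      (g : BianchiCone.Mat).det * Q.det * star ((g : BianchiCone.Mat).det) := by
    rw [congr, det_mul, det_mul, det_conjTranspose]
  rw [BianchiCone.det_eq_hdet (isHermitian_congr g hQ), BianchiCone.det_eq_hdet hQ,
    Complex.star_def] at h1
  have h2 : ((BianchiCone.hdet (congr g Q) : ℝ) : ℂ) =
      ((Complex.normSq ((g : BianchiCone.Mat).det) * BianchiCone.hdet Q : ℝ) : ℂ) := by
    rw [h1, Complex.ofReal_mul, ← Complex.mul_conj]; ring
  exact_mod_cast h2

/-- `Q(P)` is Hermitian. [folklore] -/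
theorem isHermitian_toMat (P : ℍ³) : (toMat P).IsHermitian := by
  have hr : (P.r : ℂ) ≠ 0 := Complex.ofReal_ne_zero.mpr P.r_ne_zero
  apply Matrix.IsHermitian.ext
  intro i j
  fin_cases i <;> fin_cases j <;>
    simp [toMat, Complex.conj_ofReal]

/-- The entry `Q(P)₁₁ = 1/r`. [folklore] -/
theorem toMat_one_one_re (P : ℍ³) : (toMat P 1 1).re = P.r⁻¹ := by
  simp [toMat, Complex.normSq_apply]

/-- `det Q(P) = 1`. [cite: Garrett2018, §1.3] -/
theorem hdet_toMat (P : ℍ³) : BianchiCone.hdet (toMat P) = 1 := by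
  have hr : P.r ≠ 0 := P.r_ne_zero
  simp [BianchiCone.hdet, toMat, Complex.div_re, Complex.normSq_apply, sq]
  field_simp
  ring

/-- `Q(P)` lies in the cone of positive definite Hermitian matrices. [cite: ElstrodtGrunewaldMennicke1998, Ch. 1 §1.3] -/
theorem toMat_mem_cone (P : ℍ³) : toMat P ∈ BianchiCone.cone := by
  refine ⟨isHermitian_toMat P, ?_, by rw [hdet_toMat]; exact one_pos⟩
  have hr : 0 < P.r := P.r_pos
  have h : (toMat P 0 0).re = (P.r ^ 2 + Complex.normSq P.z) / P.r := by
    simp [toMat, Complex.div_re, sq]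
    field_simp
  rw [h]
  exact div_pos (add_pos_of_pos_of_nonneg (pow_pos hr 2) (Complex.normSq_nonneg _)) hr

/-- `ofMat` inverts `toMat`. [folklore] -/
@[simp] theorem ofMat_toMat (P : ℍ³) : ofMat (toMat P) = P := by
  have hr : 0 < P.r := P.r_pos
  have h11 := toMat_one_one_re P
  have hpos : 0 < (toMat P 1 1).re ∧ 0 < BianchiCone.hdet (toMat P) := by
    rw [h11, hdet_toMat]; exact ⟨inv_pos.2 hr, one_pos⟩
  rw [ofMat, dif_pos hpos]
  apply ext_zr
  · rw [z_mk, h11]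
    have hr' : (P.r : ℂ) ≠ 0 := Complex.ofReal_ne_zero.mpr P.r_ne_zero
    simp [toMat]
    field_simp
  · rw [r_mk, h11, hdet_toMat, Real.sqrt_one]
    field_simp

/-- `ofMat` only sees matrices up to positive scalars. [folklore] -/
theorem ofMat_smul {t : ℝ} (ht : 0 < t) (Q : BianchiCone.Mat) : ofMat (t • Q) = ofMat Q := by
  have hd : BianchiCone.hdet (t • Q) = t ^ 2 * BianchiCone.hdet Q := by
    simp only [BianchiCone.hdet, Matrix.smul_apply, Complex.real_smul, Complex.mul_re,
      Complex.ofReal_re, Complex.ofReal_im, zero_mul, sub_zero, map_mul, Complex.normSq_ofReal]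
    ring
  have h11 : ((t • Q) 1 1).re = t * (Q 1 1).re := by
    simp [Matrix.smul_apply, Complex.real_smul]
  by_cases h : 0 < (Q 1 1).re ∧ 0 < BianchiCone.hdet Q
  · have h' : 0 < ((t • Q) 1 1).re ∧ 0 < BianchiCone.hdet (t • Q) := by
      rw [h11, hd]; exact ⟨mul_pos ht h.1, mul_pos (pow_pos ht 2) h.2⟩
    rw [ofMat, dif_pos h', ofMat, dif_pos h]
    apply ext_zr
    · rw [z_mk, z_mk, h11, Matrix.smul_apply, Complex.real_smul, Complex.ofReal_mul]
      have h1 : ((Q 1 1).re : ℂ) ≠ 0 := Complex.ofReal_ne_zero.mpr h.1.ne'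
      have h2 : (t : ℂ) ≠ 0 := Complex.ofReal_ne_zero.mpr ht.ne'
      rw [mul_div_mul_left _ _ h2]
    · simp only [r_mk, h11, hd]
      rw [Real.sqrt_mul (sq_nonneg t), Real.sqrt_sq ht.le]
      have hq : (Q 1 1).re ≠ 0 := h.1.ne'
      have htne : t ≠ 0 := ht.ne'
      field_simp
  · have h' : ¬ (0 < ((t • Q) 1 1).re ∧ 0 < BianchiCone.hdet (t • Q)) := by
      rw [h11, hd]
      rintro ⟨h1, h2⟩
      exact h ⟨(mul_pos_iff_of_pos_left ht).mp h1, (mul_pos_iff_of_pos_left (pow_pos ht 2)).mp h2⟩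
    rw [ofMat, dif_neg h', ofMat, dif_neg h]

/-- `toMat (ofMat Q') = (det Q')^{-1/2} Q'` for Hermitian `Q'` with `Q'₁₁ > 0` and `det Q' > 0`. [folklore] -/
theorem toMat_ofMat {Q : BianchiCone.Mat} (hQ : Q.IsHermitian) (h11 : 0 < (Q 1 1).re)
    (hd : 0 < BianchiCone.hdet Q) : toMat (ofMat Q) = (Real.sqrt (BianchiCone.hdet Q))⁻¹ • Q := by
  have hpos : 0 < (Q 1 1).re ∧ 0 < BianchiCone.hdet Q := ⟨h11, hd⟩
  have hs : 0 < Real.sqrt (BianchiCone.hdet Q) := Real.sqrt_pos.2 hd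
  have hs2 : Real.sqrt (BianchiCone.hdet Q) ^ 2 =
      (Q 0 0).re * (Q 1 1).re - ((Q 0 1).re * (Q 0 1).re + (Q 0 1).im * (Q 0 1).im) := by
    rw [Real.sq_sqrt hd.le]; rfl
  have h10 : Q 1 0 = conj (Q 0 1) := BianchiCone.apply_one_zero_of_isHermitian hQ
  have him0 : (Q 0 0).im = 0 := BianchiCone.im_apply_self_of_isHermitian hQ 0
  have him1 : (Q 1 1).im = 0 := BianchiCone.im_apply_self_of_isHermitian hQ 1
  have hq : (Q 1 1).re ≠ 0 := h11.ne'
  have hsr : Real.sqrt (BianchiCone.hdet Q) ≠ 0 := hs.ne'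
  rw [ofMat, dif_pos hpos]
  ext i j
  fin_cases i <;> fin_cases j
  · simp only [toMat, z_mk, r_mk, Fin.zero_eta, Fin.isValue, of_apply, cons_val', cons_val_zero,
      empty_val', cons_val_fin_one, Matrix.smul_apply, Complex.real_smul]
    apply Complex.ext
    · simp [Complex.div_re, Complex.div_im, Complex.normSq_apply, sq, him0]
      field_simp
      linear_combination hs2
    · simp [Complex.div_re, Complex.div_im, Complex.normSq_apply, sq, him0]
  · simp only [toMat, z_mk, r_mk, Fin.zero_eta, Fin.mk_one, Fin.isValue, of_apply, cons_val',
      cons_val_one, cons_val_fin_one, cons_val_zero, empty_val', Matrix.smul_apply, Complex.real_smul]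
    apply Complex.ext
    · simp [Complex.div_re, Complex.div_im]
      field_simp
    · simp [Complex.div_re, Complex.div_im]
      field_simp
  · simp only [toMat, z_mk, r_mk, Fin.zero_eta, Fin.mk_one, Fin.isValue, of_apply, cons_val',
      cons_val_zero, cons_val_one, empty_val', cons_val_fin_one, Matrix.smul_apply, Complex.real_smul,
      h10]
    apply Complex.ext
    · simp [Complex.div_re, Complex.div_im]
      field_simp
    · simp [Complex.div_re, Complex.div_im]
      field_simp
  · simp only [toMat, z_mk, r_mk, Fin.mk_one, Fin.isValue, of_apply, cons_val', cons_val_one,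
      cons_val_fin_one, empty_val', Matrix.smul_apply, Complex.real_smul]
    apply Complex.ext
    · simp [Complex.div_re, him1]
      field_simp
    · simp [Complex.div_im, him1]

/-- The entry `(g Q(P) gᴴ)₁₁ = (|cz + d|² + |c|²r²)/r`. [cite: BlomerHarcosMilicevic2016, §2 (‖cP + d‖² = |cz + d|² + |cr|²)] -/
theorem congr_toMat_one_one (g : GL (Fin 2) ℂ) (P : ℍ³) :
    congr g (toMat P) 1 1 =
      (((Complex.normSq (g 1 0 * P.z + g 1 1) + Complex.normSq (g 1 0) * P.r ^ 2) / P.r : ℝ) : ℂ) := by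
  have hr' : P.r ≠ 0 := P.r_ne_zero
  simp only [congr, toMat, Matrix.mul_apply, Fin.sum_univ_two, conjTranspose_apply, Matrix.of_apply,
    Matrix.cons_val', Matrix.cons_val_zero, Matrix.cons_val_one, Matrix.empty_val',
    Matrix.cons_val_fin_one]
  apply Complex.ext <;> simp [Complex.normSq_apply, Complex.div_re, Complex.div_im, sq] <;>
    field_simp <;> ring

/-- The entry `(g Q(P) gᴴ)₀₁ = ((az + b)(c̄z̄ + d̄) + ac̄r²)/r`. [cite: ElstrodtGrunewaldMennicke1998, Ch. 1 §1.1] -/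
theorem congr_toMat_zero_one (g : GL (Fin 2) ℂ) (P : ℍ³) :
    congr g (toMat P) 0 1 =
      ((g 0 0 * P.z + g 0 1) * conj (g 1 0 * P.z + g 1 1) + g 0 0 * conj (g 1 0) * (P.r : ℂ) ^ 2) /
        (P.r : ℂ) := by
  have hr : (P.r : ℂ) ≠ 0 := Complex.ofReal_ne_zero.mpr P.r_ne_zero
  have hr' : P.r ≠ 0 := P.r_ne_zero
  simp only [congr, toMat, Matrix.mul_apply, Fin.sum_univ_two, conjTranspose_apply, Matrix.of_apply,
    Matrix.cons_val', Matrix.cons_val_zero, Matrix.cons_val_one, Matrix.empty_val',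
    Matrix.cons_val_fin_one]
  apply Complex.ext <;> simp [Complex.normSq_apply, Complex.div_re, Complex.div_im, sq] <;>
    field_simp <;> ring

/-- The denominator `‖cP + d‖² = |cz + d|² + |c|²r²` of the action is positive (`(c, d) ≠ 0` as `g` is
invertible). [cite: BlomerHarcosMilicevic2016, §2 (‖cP + d‖² = |cz + d|² + |cr|²)] -/
theorem denom_pos (g : GL (Fin 2) ℂ) (P : ℍ³) :
    0 < Complex.normSq (g 1 0 * P.z + g 1 1) + Complex.normSq (g 1 0) * P.r ^ 2 := by
  by_cases hc : g 1 0 = 0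
  · have hd : g 1 1 ≠ 0 := by
      intro hd
      have hdet : ((g : BianchiCone.Mat).det) = 0 := by
        rw [Matrix.det_fin_two]
        change g 0 0 * g 1 1 - g 0 1 * g 1 0 = 0
        rw [hc, hd]; ring
      exact (g.isUnit.map Matrix.detMonoidHom).ne_zero hdet
    rw [hc, zero_mul, zero_add, map_zero, zero_mul, add_zero]
    exact Complex.normSq_pos.2 hd
  · have h1 : 0 < Complex.normSq (g 1 0) * P.r ^ 2 := mul_pos (Complex.normSq_pos.2 hc) (by
      have := P.r_pos; positivity)
    have h2 : 0 ≤ Complex.normSq (g 1 0 * P.z + g 1 1) := Complex.normSq_nonneg _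
    linarith

/-- **The action of `GL₂(ℂ)` on `ℍ³`**: `g • P` is the point of `g Q(P) gᴴ` — the action of
`PGL₂(ℂ) ≅ Isom⁺(ℍ³)` lifted to `GL₂(ℂ)` (centre acting trivially), extending
`M P = (aP + b)(cP + d)⁻¹` on `SL₂(ℂ)`. [cite: BlomerHarcosMilicevic2016, §2 (gP = (aP + b)(cP + d)⁻¹; the centre acts trivially)] -/
instance instSMul : SMul (GL (Fin 2) ℂ) ℍ³ := ⟨fun g P => ofMat (congr g (toMat P))⟩

/-- Unfolding the action. [folklore] -/
theorem smul_def (g : GL (Fin 2) ℂ) (P : ℍ³) : g • P = ofMat (congr g (toMat P)) := rfl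

/-- **`GL₂(ℂ)` acts on `ℍ³`.** [cite: BlomerHarcosMilicevic2016, §2 (the action of SL₂(ℂ) lifts uniquely to GL₂(ℂ))] -/
instance instMulAction : MulAction (GL (Fin 2) ℂ) ℍ³ where
  one_smul P := by
    change ofMat (congr 1 (toMat P)) = P
    rw [congr_one, ofMat_toMat]
  mul_smul g h P := by
    change ofMat (congr (g * h) (toMat P)) = ofMat (congr g (toMat (ofMat (congr h (toMat P)))))
    have hQ : (congr h (toMat P)).IsHermitian := isHermitian_congr h (isHermitian_toMat P)
    have h11 : 0 < (congr h (toMat P) 1 1).re := by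
      rw [congr_toMat_one_one, Complex.ofReal_re]
      exact div_pos (denom_pos h P) P.r_pos
    have hd : 0 < BianchiCone.hdet (congr h (toMat P)) := by
      rw [hdet_congr h (isHermitian_toMat P), hdet_toMat, mul_one]
      exact Complex.normSq_pos.2 ((h.isUnit.map Matrix.detMonoidHom).ne_zero)
    rw [toMat_ofMat hQ h11 hd, congr_smul, ofMat_smul (inv_pos.2 (Real.sqrt_pos.2 hd)), congr_mul]

/-- **The height of `g • P`**: `Im(g P) = |det g| r / (|cz + d|² + |c|²r²)`.
[cite: BlomerHarcosMilicevic2016, §2 (Im(gP)/Im(P) = |det g| / ‖cP + d‖²)] -/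
theorem smul_r (g : GL (Fin 2) ℂ) (P : ℍ³) :
    (g • P).r = ‖(g : BianchiCone.Mat).det‖ * P.r /
      (Complex.normSq (g 1 0 * P.z + g 1 1) + Complex.normSq (g 1 0) * P.r ^ 2) := by
  have hD := denom_pos g P
  have h11 : (congr g (toMat P) 1 1).re =
      (Complex.normSq (g 1 0 * P.z + g 1 1) + Complex.normSq (g 1 0) * P.r ^ 2) / P.r := by
    rw [congr_toMat_one_one, Complex.ofReal_re]
  have hd : BianchiCone.hdet (congr g (toMat P)) = Complex.normSq ((g : BianchiCone.Mat).det) := by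
    rw [hdet_congr g (isHermitian_toMat P), hdet_toMat, mul_one]
  have hpos : 0 < (congr g (toMat P) 1 1).re ∧ 0 < BianchiCone.hdet (congr g (toMat P)) := by
    rw [h11, hd]
    exact ⟨div_pos hD P.r_pos, Complex.normSq_pos.2 ((g.isUnit.map Matrix.detMonoidHom).ne_zero)⟩
  rw [smul_def, ofMat, dif_pos hpos, r_mk, h11, hd, ← Complex.norm_def]
  have hr := P.r_ne_zero
  field_simp

/-- **The `z`-coordinate of `g • P`**: `((az + b)(c̄z̄ + d̄) + ac̄ r²) / (|cz + d|² + |c|²r²)`.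
[cite: ElstrodtGrunewaldMennicke1998, Ch. 1 §1.1] -/
theorem smul_z (g : GL (Fin 2) ℂ) (P : ℍ³) :
    (g • P).z = ((g 0 0 * P.z + g 0 1) * conj (g 1 0 * P.z + g 1 1) + g 0 0 * conj (g 1 0) * (P.r : ℂ) ^ 2) /
      ((Complex.normSq (g 1 0 * P.z + g 1 1) + Complex.normSq (g 1 0) * P.r ^ 2 : ℝ) : ℂ) := by
  have hD := denom_pos g P
  have h11 : (congr g (toMat P) 1 1).re =
      (Complex.normSq (g 1 0 * P.z + g 1 1) + Complex.normSq (g 1 0) * P.r ^ 2) / P.r := by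
    rw [congr_toMat_one_one, Complex.ofReal_re]
  have hd : BianchiCone.hdet (congr g (toMat P)) = Complex.normSq ((g : BianchiCone.Mat).det) := by
    rw [hdet_congr g (isHermitian_toMat P), hdet_toMat, mul_one]
  have hpos : 0 < (congr g (toMat P) 1 1).re ∧ 0 < BianchiCone.hdet (congr g (toMat P)) := by
    rw [h11, hd]
    exact ⟨div_pos hD P.r_pos, Complex.normSq_pos.2 ((g.isUnit.map Matrix.detMonoidHom).ne_zero)⟩
  rw [smul_def, ofMat, dif_pos hpos, z_mk, h11, congr_toMat_zero_one]
  have hr : (P.r : ℂ) ≠ 0 := Complex.ofReal_ne_zero.mpr P.r_ne_zero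
  have hD' : ((Complex.normSq (g 1 0 * P.z + g 1 1) + Complex.normSq (g 1 0) * P.r ^ 2 : ℝ) : ℂ) ≠ 0 :=
    Complex.ofReal_ne_zero.mpr hD.ne'
  push_cast
  field_simp

/-- **Upper triangular matrices act affinely**: `(a b; 0 d) • (z, r) = ((az + b)/d, |a/d| r)`; in
particular `(1 b; 0 ϖ) P = ((z + b)/ϖ, r/|ϖ|)` and `(ϖ 0; 0 1) P = (ϖz, |ϖ|r)`.
[cite: BlomerHarcosMilicevic2016, §2 (Im(gP)/Im(P) = |det g| / ‖cP + d‖²; matrices (a b; 0 d) in T_n)] -/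
theorem smul_upperTriangular (g : GL (Fin 2) ℂ) (hc : g 1 0 = 0) (P : ℍ³) :
    (g • P).z = (g 0 0 * P.z + g 0 1) / g 1 1 ∧ (g • P).r = ‖g 0 0 / g 1 1‖ * P.r := by
  have hd : g 1 1 ≠ 0 := by
    intro hd
    have hdet : ((g : BianchiCone.Mat).det) = 0 := by
      rw [Matrix.det_fin_two]
      change g 0 0 * g 1 1 - g 0 1 * g 1 0 = 0
      rw [hc, hd]; ring
    exact (g.isUnit.map Matrix.detMonoidHom).ne_zero hdet
  have hdet : (g : BianchiCone.Mat).det = g 0 0 * g 1 1 := by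
    rw [Matrix.det_fin_two]
    change g 0 0 * g 1 1 - g 0 1 * g 1 0 = _
    rw [hc]; ring
  have hnd : Complex.normSq (g 1 1) ≠ 0 := (Complex.normSq_pos.2 hd).ne'
  constructor
  · rw [smul_z, hc]
    simp only [zero_mul, zero_add, map_zero, mul_zero, add_zero]
    rw [div_eq_div_iff (Complex.ofReal_ne_zero.mpr hnd) hd, Complex.normSq_eq_conj_mul_self]
    ring
  · rw [smul_r, hc, hdet]
    simp only [zero_mul, zero_add, map_zero, add_zero, norm_mul, norm_div]
    rw [Complex.normSq_eq_norm_sq]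
    have : ‖g 1 1‖ ≠ 0 := norm_ne_zero_iff.mpr hd
    field_simp

/-- **The centre acts trivially**: `(a 0; 0 a) P = P`. [cite: BlomerHarcosMilicevic2016, §2 (the centre of GL₂(ℂ) acts trivially)] -/
theorem smul_scalar (g : GL (Fin 2) ℂ) (hc : g 1 0 = 0) (hb : g 0 1 = 0) (had : g 0 0 = g 1 1) (P : ℍ³) :
    g • P = P := by
  obtain ⟨hz, hr⟩ := smul_upperTriangular g hc P
  have hd : g 1 1 ≠ 0 := by
    intro hd
    have hdet : ((g : BianchiCone.Mat).det) = 0 := by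
      rw [Matrix.det_fin_two]
      change g 0 0 * g 1 1 - g 0 1 * g 1 0 = 0
      rw [hc, hd]; ring
    exact (g.isUnit.map Matrix.detMonoidHom).ne_zero hdet
  apply ext_zr
  · rw [hz, hb, had, add_zero, mul_div_cancel_left₀ _ hd]
  · rw [hr, had, div_self hd, norm_one, one_mul]

/-! ### The action of `SL₂(ℂ)` and the translations -/

/-- **`SL₂(ℂ)` acts on `ℍ³`** through `SL₂(ℂ) → GL₂(ℂ)` (`M P = (aP + b)(cP + d)⁻¹` in the quaternions).
[cite: ElstrodtGrunewaldMennicke1998, Ch. 1 §1.1] -/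
instance instMulActionSL : MulAction SL(2, ℂ) ℍ³ := MulAction.compHom ℍ³ Matrix.SpecialLinearGroup.toGL

/-- The `SL₂(ℂ)`-action is the `GL₂(ℂ)`-action of the image matrix. [folklore] -/
theorem sl_smul_def (g : SL(2, ℂ)) (P : ℍ³) : g • P = (g : GL (Fin 2) ℂ) • P := rfl

/-- **`SL₂(ℂ)` formula for the height**: `Im(M P) = r / (|cz + d|² + |c|²r²)`.
[cite: ElstrodtGrunewaldMennicke1998, Ch. 1 §1.1] -/
theorem sl_smul_r (g : SL(2, ℂ)) (P : ℍ³) :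
    (g • P).r = P.r / (Complex.normSq (g 1 0 * P.z + g 1 1) + Complex.normSq (g 1 0) * P.r ^ 2) := by
  rw [sl_smul_def, smul_r]
  have h : ((g : GL (Fin 2) ℂ) : BianchiCone.Mat).det = 1 := g.det_coe
  rw [h, norm_one, one_mul]
  rfl

/-- **`SL₂(ℂ)` formula for `z`**: `((az + b)(c̄z̄ + d̄) + ac̄ r²) / (|cz + d|² + |c|²r²)`.
[cite: ElstrodtGrunewaldMennicke1998, Ch. 1 §1.1] -/
theorem sl_smul_z (g : SL(2, ℂ)) (P : ℍ³) :
    (g • P).z = ((g 0 0 * P.z + g 0 1) * conj (g 1 0 * P.z + g 1 1) + g 0 0 * conj (g 1 0) * (P.r : ℂ) ^ 2) /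
      ((Complex.normSq (g 1 0 * P.z + g 1 1) + Complex.normSq (g 1 0) * P.r ^ 2 : ℝ) : ℂ) := by
  rw [sl_smul_def, smul_z]
  rfl

/-- **The translation** `n_ω = (1 ω; 0 1) ∈ SL₂(ℂ)` (an element of the unipotent radical `N ≅ ℂ`).
[cite: Garrett2018, §1.1] -/
def unipotent (ω : ℂ) : SL(2, ℂ) :=
  ⟨!![1, ω; 0, 1], by rw [Matrix.det_fin_two_of]; ring⟩

/-- `n_ω (z, r) = (z + ω, r)`. [cite: Garrett2018, §1.3 Claim 1.3.2] -/
theorem unipotent_smul (ω : ℂ) (P : ℍ³) : (unipotent ω • P).z = P.z + ω ∧ (unipotent ω • P).r = P.r := by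
  have h := smul_upperTriangular ((unipotent ω : SL(2, ℂ)) : GL (Fin 2) ℂ) rfl P
  rw [← sl_smul_def] at h
  refine ⟨?_, ?_⟩
  · rw [h.1]
    change (1 * P.z + ω) / 1 = _
    rw [one_mul, div_one]
  · rw [h.2]
    change ‖(1 : ℂ) / 1‖ * P.r = _
    simp

/-- `n_{ω + ω'} = n_ω n_{ω'}`. [folklore] -/
theorem unipotent_add (ω ω' : ℂ) : unipotent (ω + ω') = unipotent ω * unipotent ω' := by
  ext i j
  fin_cases i <;> fin_cases j <;> simp [unipotent, Matrix.mul_apply, Fin.sum_univ_two]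
  ring

/-! ## 3. The Laplace–Beltrami operator and `C²` functions -/

/-- **The Laplace–Beltrami operator of `ℍ³`** on functions of the ambient `ℂ × ℝ ∋ (x + iy, r)`:
`Δ U = r² (∂²_x U + ∂²_y U + ∂²_r U) - r ∂_r U`, the second partials being Mathlib's
`iteratedFDeriv ℝ 2 U p ![v, v]` in the coordinate directions `v = (1, 0), (i, 0), (0, 1)` and
`∂_r U = fderiv ℝ U p (0, 1)`. A non-positive operator; an eigenfunction with eigenvalue `λ` solves
`Δ U + λ U = 0`. [cite: Garrett2018, §1.6] -/
def laplaceBeltrami (U : ℂ × ℝ → ℂ) (p : ℂ × ℝ) : ℂ :=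
  (p.2 : ℂ) ^ 2 *
      (iteratedFDeriv ℝ 2 U p ![((1 : ℂ), (0 : ℝ)), ((1 : ℂ), (0 : ℝ))] +
        iteratedFDeriv ℝ 2 U p ![(Complex.I, (0 : ℝ)), (Complex.I, (0 : ℝ))] +
        iteratedFDeriv ℝ 2 U p ![((0 : ℂ), (1 : ℝ)), ((0 : ℂ), (1 : ℝ))]) -
    (p.2 : ℂ) * fderiv ℝ U p ((0 : ℂ), (1 : ℝ))

/-- **The hyperbolic Laplacian of `u : ℍ³ → ℂ`** at `P`: `Δ` of the extension `u ∘ ofProd` (which agrees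
with `u` on the open half-space) — the `ℍ³` mirror of `hypLaplacian`.
[cite: BlomerHarcosMilicevic2016, §1 (the Laplace operator r²(∂²_x + ∂²_y + ∂²_r) - r∂_r)] -/
def hypLaplacian3 (u : ℍ³ → ℂ) (P : ℍ³) : ℂ :=
  laplaceBeltrami (u ∘ ofProd) (P : ℂ × ℝ)

/-- **`u` is of class `C²`**: the extension `u ∘ ofProd` is `C²` over `ℝ` on the open half-space
`{r > 0} ⊆ ℂ × ℝ` (mirror of `IsC2` for `ℍ`; the regularity asked of Laplace eigenfunctions). [folklore] -/
def IsC2 (u : ℍ³ → ℂ) : Prop :=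
  ContDiffOn ℝ 2 (u ∘ ofProd) {p : ℂ × ℝ | 0 < p.2}

/-- `Δ` of a constant vanishes. [folklore] -/
@[simp] theorem laplaceBeltrami_const (c : ℂ) (p : ℂ × ℝ) : laplaceBeltrami (fun _ => c) p = 0 := by
  simp [laplaceBeltrami, iteratedFDeriv_const_of_ne (𝕜 := ℝ) (E := ℂ × ℝ) two_ne_zero c]

/-- `Δ c = 0` on `ℍ³`. [folklore] -/
@[simp] theorem hypLaplacian3_const (c : ℂ) (P : ℍ³) : hypLaplacian3 (fun _ => c) P = 0 := by
  have h : ((fun _ : ℍ³ => c) ∘ ofProd) = fun _ => c := rfl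
  rw [hypLaplacian3, h, laplaceBeltrami_const]

/-- **The height function solves `Δ r = -r`**: `U(z, r) = r` has vanishing second derivatives and
`∂_r U = 1`, so `Δ r + 1 · r = 0` — `r = r^s` at `s = 1`, eigenvalue `λ = s(2 - s) = 1`, the bottom of
the tempered spectrum `λ = 1 + t²`. [cite: BlomerHarcosMilicevic2016, §1 (t = √(λ - 1)) & §4 (λ = 1 + t²)] -/
theorem laplaceBeltrami_snd (p : ℂ × ℝ) : laplaceBeltrami (fun q : ℂ × ℝ => (q.2 : ℂ)) p = -(p.2 : ℂ) := by
  set L : ℂ × ℝ →L[ℝ] ℂ := Complex.ofRealCLM.comp (ContinuousLinearMap.snd ℝ ℂ ℝ) with hL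
  have hU : (fun q : ℂ × ℝ => (q.2 : ℂ)) = ⇑L := by
    funext q; simp [hL]
  have h1 : fderiv ℝ (⇑L) = fun _ => L := funext fun x => L.fderiv
  have h2 : ∀ m : Fin 2 → ℂ × ℝ, iteratedFDeriv ℝ 2 (⇑L) p m = 0 := fun m => by
    rw [iteratedFDeriv_two_apply, h1]; simp
  rw [laplaceBeltrami, hU, h2, h2, h2, h1]
  simp [hL]

/-- The height function `P ↦ r` is `C²`. [folklore] -/
theorem isC2_r : IsC2 (fun P : ℍ³ => (P.r : ℂ)) := by
  have h : Set.EqOn ((fun P : ℍ³ => (P.r : ℂ)) ∘ ofProd) (fun q : ℂ × ℝ => (q.2 : ℂ)) {p | 0 < p.2} := by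
    intro p hp
    simp only [Function.comp_apply, ofProd_of_pos hp]
    rfl
  refine ContDiffOn.congr ?_ h
  exact (Complex.ofRealCLM.contDiff.comp contDiff_snd).contDiffOn

/-- **`Δ r + r = 0` on `ℍ³`** (`λ = 1` eigenfunction). [cite: BlomerHarcosMilicevic2016, §4 (λ = 1 + t²)] -/
theorem hypLaplacian3_r (P : ℍ³) :
    hypLaplacian3 (fun Q : ℍ³ => (Q.r : ℂ)) P + 1 * (P.r : ℂ) = 0 := by
  have hev : ((fun Q : ℍ³ => (Q.r : ℂ)) ∘ ofProd) =ᶠ[nhds (P : ℂ × ℝ)] fun q : ℂ × ℝ => (q.2 : ℂ) := by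
    filter_upwards [isOpen_halfSpace.mem_nhds P.2] with p hp
    simp only [Function.comp_apply, ofProd_of_pos hp]
    rfl
  have h2 := (hev.iteratedFDeriv ℝ 2).eq_of_nhds
  have h1 := hev.fderiv_eq (𝕜 := ℝ)
  have key : hypLaplacian3 (fun Q : ℍ³ => (Q.r : ℂ)) P = laplaceBeltrami (fun q : ℂ × ℝ => (q.2 : ℂ)) P := by
    simp only [hypLaplacian3, laplaceBeltrami, h2, h1]
  rw [key, laplaceBeltrami_snd]
  change -(P.r : ℂ) + 1 * (P.r : ℂ) = 0
  ring

end UpperHalfSpace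

/-! ## 4. Maass cusp forms for a subgroup of `SL₂(ℂ)` -/

section CuspForms

open UpperHalfSpace


/-- **The zero-th Fourier coefficient of `u` at the cusp `A∞` with respect to the period lattice
`ℤω₁ ⊕ ℤω₂ ⊆ ℂ`**, at the point `P`:
`∫₀¹ ∫₀¹ u (A (1 sω₁+tω₂; 0 1) P) dt ds = covol⁻¹ ∫_{ℂ/Λ} u(A(P + w)) dw`
(the constant term `c_P f` along the unipotent radical). [cite: Garrett2018, §1.7] -/
def cuspCoeffZero (A : SL(2, ℂ)) (ω₁ ω₂ : ℂ) (u : ℍ³ → ℂ) (P : ℍ³) : ℂ :=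
  ∫ s in (0 : ℝ)..1, ∫ t in (0 : ℝ)..1, u ((A * unipotent ((s : ℂ) * ω₁ + (t : ℂ) * ω₂)) • P)

/-- **Maass cusp forms on `Γ\ℍ³` with Laplace eigenvalue `λ`** for a subgroup `Γ ≤ SL₂(ℂ)` (e.g. a
congruence subgroup of a Bianchi group `SL₂(𝓞_K)`, `K` imaginary quadratic): `u : ℍ³ → ℂ` is `C²`,
`Γ`-invariant, satisfies `Δu + λu = 0`, is bounded, and is cuspidal — at every cusp of `Γ`, i.e. for
every `A ∈ SL₂(ℂ)` and every rank-`2` lattice of translations `(1 ω; 0 1)`, `ω ∈ ℤω₁ ⊕ ℤω₂`, contained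
in `A⁻¹ΓA`, the zero-th Fourier coefficient of `u ∘ A` vanishes identically (the Gelfand condition).
Boundedness stands in for "moderate growth" (cusp forms decay rapidly at the cusps, so no cusp form
is lost, and bounded functions have moderate growth). For `K = ℚ(i)`, `Γ = Γ₀(N)` these are the cusp
forms with `λ = 1 + t²` of [BlomerHarcosMilicevic2016, §1, §4].
[cite: Garrett2018, §1.7 (cuspforms, Thm 1.7.1)] -/
structure IsBianchiMaassCuspForm (Γ : Subgroup SL(2, ℂ)) (lam : ℂ) (u : ℍ³ → ℂ) : Prop where
  isC2 : IsC2 u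
  invariant : ∀ γ ∈ Γ, ∀ P : ℍ³, u (γ • P) = u P
  eigen : ∀ P : ℍ³, hypLaplacian3 u P + lam * u P = 0
  bounded : ∃ C : ℝ, ∀ P : ℍ³, ‖u P‖ ≤ C
  cuspidal : ∀ (A : SL(2, ℂ)) (ω₁ ω₂ : ℂ), LinearIndependent ℝ ![ω₁, ω₂] →
    A * unipotent ω₁ * A⁻¹ ∈ Γ → A * unipotent ω₂ * A⁻¹ ∈ Γ →
    ∀ P : ℍ³, cuspCoeffZero A ω₁ ω₂ u P = 0

/-- The zero function is a (trivial) Maass cusp form for every `Γ` and `λ`. [folklore] -/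
theorem IsBianchiMaassCuspForm.zero (Γ : Subgroup SL(2, ℂ)) (lam : ℂ) :
    IsBianchiMaassCuspForm Γ lam (fun _ => 0) where
  isC2 := contDiffOn_const
  invariant := fun _ _ _ => rfl
  eigen := fun P => by rw [hypLaplacian3_const]; ring
  bounded := ⟨0, fun _ => by simp⟩
  cuspidal := fun A ω₁ ω₂ _ _ _ P => by simp [cuspCoeffZero]

/-- **Lowering the level**: a Maass cusp form for `Γ` is one for every subgroup `Γ' ≤ Γ` (the cusps
of `Γ'` — the `A` with a rank-`2` lattice of translations in `A⁻¹Γ'A` — are cusps of `Γ`). [folklore] -/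
theorem IsBianchiMaassCuspForm.mono {Γ Γ' : Subgroup SL(2, ℂ)} {lam : ℂ} {u : ℍ³ → ℂ}
    (hu : IsBianchiMaassCuspForm Γ lam u) (h : Γ' ≤ Γ) : IsBianchiMaassCuspForm Γ' lam u where
  isC2 := hu.isC2
  invariant := fun γ hγ P => hu.invariant γ (h hγ) P
  eigen := hu.eigen
  bounded := hu.bounded
  cuspidal := fun A ω₁ ω₂ hli h₁ h₂ P => hu.cuspidal A ω₁ ω₂ hli (h h₁) (h h₂) P

end CuspForms

/-! ## 5. Bianchi groups: congruence subgroups of `SL₂(𝓞_K)` and Hecke operators -/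

namespace Bianchi

open UpperHalfSpace

section CongruenceSubgroups

variable {R : Type*} [CommRing R]

/-- **`Γ₀(𝔫) = {(a b; c d) ∈ SL₂(R) : c ∈ 𝔫}`** for an ideal `𝔫` of a commutative ring `R`
(for `R = ℤ[i]`, `𝔫 = (N)`: [BlomerHarcosMilicevic2016, §1]). [cite: BlomerHarcosMilicevic2016, §1 (Γ₀(N))] -/
def Gamma0 (𝔫 : Ideal R) : Subgroup SL(2, R) where
  carrier := {γ | γ 1 0 ∈ 𝔫}
  mul_mem' := by
    intro γ δ hγ hδ
    change (γ * δ) 1 0 ∈ 𝔫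
    rw [Matrix.SpecialLinearGroup.coe_mul, Matrix.mul_apply, Fin.sum_univ_two]
    exact 𝔫.add_mem (𝔫.mul_mem_right _ hγ) (𝔫.mul_mem_left _ hδ)
  one_mem' := by
    change (1 : SL(2, R)) 1 0 ∈ 𝔫
    simp
  inv_mem' := by
    intro γ hγ
    change (γ⁻¹) 1 0 ∈ 𝔫
    rw [Matrix.SpecialLinearGroup.SL2_inv_expl]
    change -(γ 1 0) ∈ 𝔫
    exact 𝔫.neg_mem hγ

/-- Membership in `Γ₀(𝔫)`. [folklore] -/
@[simp] theorem mem_Gamma0 {𝔫 : Ideal R} {γ : SL(2, R)} : γ ∈ Gamma0 𝔫 ↔ γ 1 0 ∈ 𝔫 := Iff.rfl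

/-- **`Γ₁(𝔫) = {(a b; c d) ∈ SL₂(R) : c ∈ 𝔫, d ≡ 1 mod 𝔫}`** (then also `a ≡ 1 mod 𝔫`). [folklore] -/
def Gamma1 (𝔫 : Ideal R) : Subgroup SL(2, R) where
  carrier := {γ | γ 1 0 ∈ 𝔫 ∧ γ 1 1 - 1 ∈ 𝔫}
  mul_mem' := by
    rintro γ δ ⟨hγc, hγd⟩ ⟨hδc, hδd⟩
    refine ⟨?_, ?_⟩
    · change (γ * δ) 1 0 ∈ 𝔫
      rw [Matrix.SpecialLinearGroup.coe_mul, Matrix.mul_apply, Fin.sum_univ_two]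
      exact 𝔫.add_mem (𝔫.mul_mem_right _ hγc) (𝔫.mul_mem_left _ hδc)
    · change (γ * δ) 1 1 - 1 ∈ 𝔫
      rw [Matrix.SpecialLinearGroup.coe_mul, Matrix.mul_apply, Fin.sum_univ_two]
      have e : γ 1 0 * δ 0 1 + γ 1 1 * δ 1 1 - 1 =
          γ 1 0 * δ 0 1 + (γ 1 1 - 1) * δ 1 1 + (δ 1 1 - 1) := by ring
      rw [e]
      exact 𝔫.add_mem (𝔫.add_mem (𝔫.mul_mem_right _ hγc) (𝔫.mul_mem_right _ hγd)) hδd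
  one_mem' := by
    refine ⟨?_, ?_⟩
    · change (1 : SL(2, R)) 1 0 ∈ 𝔫; simp
    · change (1 : SL(2, R)) 1 1 - 1 ∈ 𝔫; simp
  inv_mem' := by
    rintro γ ⟨hγc, hγd⟩
    have hdet : γ 0 0 * γ 1 1 - γ 0 1 * γ 1 0 = 1 := by
      have h := γ.det_coe
      rw [Matrix.det_fin_two] at h
      exact h
    refine ⟨?_, ?_⟩
    · change (γ⁻¹) 1 0 ∈ 𝔫
      rw [Matrix.SpecialLinearGroup.SL2_inv_expl]
      change -(γ 1 0) ∈ 𝔫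
      exact 𝔫.neg_mem hγc
    · change (γ⁻¹) 1 1 - 1 ∈ 𝔫
      rw [Matrix.SpecialLinearGroup.SL2_inv_expl]
      change γ 0 0 - 1 ∈ 𝔫
      have e : γ 0 0 - 1 = -(γ 0 0 * (γ 1 1 - 1)) + γ 0 1 * γ 1 0 := by linear_combination hdet
      rw [e]
      exact 𝔫.add_mem (𝔫.neg_mem (𝔫.mul_mem_left _ hγd)) (𝔫.mul_mem_left _ hγc)

/-- Membership in `Γ₁(𝔫)`. [folklore] -/
@[simp] theorem mem_Gamma1 {𝔫 : Ideal R} {γ : SL(2, R)} :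
    γ ∈ Gamma1 𝔫 ↔ γ 1 0 ∈ 𝔫 ∧ γ 1 1 - 1 ∈ 𝔫 := Iff.rfl

/-- **The principal congruence subgroup `Γ(𝔫) = ker (SL₂(R) → SL₂(R/𝔫))`.** [folklore] -/
abbrev Gamma (𝔫 : Ideal R) : Subgroup SL(2, R) :=
  (Matrix.SpecialLinearGroup.map (Ideal.Quotient.mk 𝔫)).ker

/-- `Γ₁(𝔫) ≤ Γ₀(𝔫)`. [folklore] -/
theorem Gamma1_le_Gamma0 (𝔫 : Ideal R) : Gamma1 𝔫 ≤ Gamma0 𝔫 := fun _ h => h.1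

/-- `Γ(𝔫) ≤ Γ₁(𝔫)`. [folklore] -/
theorem Gamma_le_Gamma1 (𝔫 : Ideal R) : Gamma 𝔫 ≤ Gamma1 𝔫 := by
  intro γ hγ
  rw [MonoidHom.mem_ker] at hγ
  have h10 : Ideal.Quotient.mk 𝔫 (γ 1 0) = 0 := by
    have := congrArg (fun m : SL(2, R ⧸ 𝔫) => m 1 0) hγ
    simpa using this
  have h11 : Ideal.Quotient.mk 𝔫 (γ 1 1) = 1 := by
    have := congrArg (fun m : SL(2, R ⧸ 𝔫) => m 1 1) hγ
    simpa using this
  refine ⟨Ideal.Quotient.eq_zero_iff_mem.mp h10, ?_⟩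
  rw [← Ideal.Quotient.eq_zero_iff_mem, map_sub, h11, map_one, sub_self]

end CongruenceSubgroups

variable (K : Type*) [Field K] [NumberField K] (σ : K →+* ℂ)

/-- **The Bianchi group inside `SL₂(ℂ)`**: `SL₂(𝓞_K) → SL₂(ℂ)` along the embedding `σ : K → ℂ`
(for `K` imaginary quadratic its image is the Bianchi group, a discrete subgroup of `SL₂(ℂ)`).
[cite: BlomerHarcosMilicevic2016, §1] -/
abbrev toSL2C : SL(2, 𝓞 K) →* SL(2, ℂ) :=
  Matrix.SpecialLinearGroup.map (σ.comp (algebraMap (𝓞 K) K))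

/-- The complex number `σ(x)` of an algebraic integer `x ∈ 𝓞_K`. [folklore] -/
abbrev emb (x : 𝓞 K) : ℂ := σ (algebraMap (𝓞 K) K x)

/-- The `GL₂(ℂ)` matrix `(a b; 0 d)` for `a d ≠ 0`. [folklore] -/
def upperGL (a b d : ℂ) (ha : a ≠ 0) (hd : d ≠ 0) : GL (Fin 2) ℂ :=
  Matrix.GeneralLinearGroup.mkOfDetNeZero !![a, b; 0, d] (by rw [Matrix.det_fin_two_of]; simp [ha, hd])

/-- **The Hecke operator at a non-zero principal ideal `(ϖ)` of `𝓞_K`** on functions on `ℍ³`, with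
"character value" `χ(ϖ)` (the scalar by which the diamond operator / central character acts; `χ = 1`
for level `Γ₀`):
`T_ϖ u (P) = Σ_{b mod ϖ} u((1 b; 0 ϖ) P) + χ(ϖ) u((ϖ 0; 0 1) P) = Σ_{b mod ϖ} u((z+b)/ϖ, r/|ϖ|) + χ(ϖ) u(ϖz, |ϖ|r)`,
`b` running over `Quotient.out` representatives of `𝓞_K/(ϖ)` (for `u` invariant under the translations
`(1 β; 0 1)`, `β ∈ 𝓞_K`, the sum does not depend on the representatives). Unnormalised: for
`Γ₀(N) ≤ SL₂(ℤ[i])`, `χ = 1`, `ϖ` prime, the `T_ϖ` of [BlomerHarcosMilicevic2016, §2] is `|ϖ|⁻¹ T_ϖ`. Junk value `0`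
at `ϖ = 0`. -- TODO(general form): non-principal `𝔭` (class number `> 1`).
[cite: BlomerHarcosMilicevic2016, §2 (Hecke operator T_n)] -/
def heckeOperator (χ : 𝓞 K → ℂ) (ϖ : 𝓞 K) (u : ℍ³ → ℂ) (P : ℍ³) : ℂ :=
  if h : emb K σ ϖ = 0 then 0 else
    (∑ᶠ b : 𝓞 K ⧸ Ideal.span {ϖ}, u (upperGL 1 (emb K σ (Quotient.out b)) (emb K σ ϖ) one_ne_zero h • P)) +
      χ ϖ * u (upperGL (emb K σ ϖ) 0 1 h one_ne_zero • P)

/-- The two kinds of matrices in `T_ϖ` act by `(1 b; 0 ϖ) P = ((z + b)/ϖ, r/|ϖ|)` and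
`(ϖ 0; 0 1) P = (ϖ z, |ϖ| r)`. [cite: BlomerHarcosMilicevic2016, §2 (matrices (a b; 0 d) in T_n)] -/
theorem upperGL_smul (a b d : ℂ) (ha : a ≠ 0) (hd : d ≠ 0) (P : ℍ³) :
    (upperGL a b d ha hd • P).z = (a * P.z + b) / d ∧ (upperGL a b d ha hd • P).r = ‖a / d‖ * P.r :=
  smul_upperTriangular (upperGL a b d ha hd) rfl P

/-- **Bianchi–Maass cusp forms of level `Γ ≤ SL₂(𝓞_K)`** (e.g. `Γ = Γ₁(𝔫)`, `Γ₀(𝔫)`, `Γ(𝔫)`) and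
eigenvalue `λ`, along the embedding `σ`: Maass cusp forms for the image of `Γ` in `SL₂(ℂ)`.
[cite: BlomerHarcosMilicevic2016, §1 & §4] -/
abbrev IsMaassCuspFormOfLevel (Γ : Subgroup SL(2, 𝓞 K)) (lam : ℂ) (u : ℍ³ → ℂ) : Prop :=
  IsBianchiMaassCuspForm (Γ.map (toSL2C K σ)) lam u

end Bianchi

end Literature.NumberTheory.Automorphic
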